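import Summits.RiemannHypothesis.RiemannHypothesis.Theorems.IntegerScrewTopBlockPosSoundB

/-!
# P-POS soundness C: `μ_j` monotonicity, the table `muTab`, and `certify_sound`

Soundness of the P-POS kernel checker `IntegerScrewTopBlockPosDefs` for the crux `TopBlockWavePos31`
(= `Manifest.TopBlockWavePos (21/50) 8 31`) of route `ScrewNyquistFloor` (planner sos-theory gen17).
PROOF-ONLY module (all definitions, incl. the real twins `FR`, `mu`, `GoodBox`, …, live in `IntegerScrewTopBlockPosDefs`).
Part C: `μ_j(x) = −log(1 − jx)/x` is monotone in `x` (concavity of `log`), the shipped table `muTab X`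
encloses `μ_j(X/DX)` whenever `muTabOK X = true` (checked in-kernel against Mathlib's `log` bounds via
`logOneSubD`), hence `GoodBox` follows from `accept`, is stable under the two bisections, and
`certify_sound : certify fuel P0 P1 X0 X1 = true → GoodBox P0 P1 X0 X1` by induction on `fuel`.
Nothing here bears on the truth of RH; the block `D16` is prime-free.
-/

set_option linter.dupNamespace false
set_option autoImplicit false

namespace Summit.RiemannHypothesis.RiemannHypothesis.Theorems.IntegerScrew.TopBlockPos

open Literature.Analysis.ValidatedNumerics Literature.Analysis.ValidatedNumerics.Numerics FI

/-! ## Soundness, part C: from `certify = true` to positivity on the box -/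

section Certify

/-- Soundness/assembly step `DX_pos` (P-POS package; see the module docstring). -/
theorem DX_pos : (0 : ℝ) < DX := by norm_num [DX]

/-- Concavity of `log` between `1 − v` and `1`: `t·log(1 − v) ≤ log(1 − t v)`. -/
theorem log_one_sub_concave {t v : ℝ} (ht0 : 0 ≤ t) (ht1 : t ≤ 1) (hv : v < 1) :
    t * Real.log (1 - v) ≤ Real.log (1 - t * v) := by
  have hc := (strictConcaveOn_log_Ioi).concaveOn
  have h := hc.2 (show (1 - v) ∈ Set.Ioi (0 : ℝ) by simp only [Set.mem_Ioi]; linarith)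
    (show (1 : ℝ) ∈ Set.Ioi (0 : ℝ) by simp) ht0 (show 0 ≤ 1 - t by linarith) (by ring)
  simp only [smul_eq_mul, Real.log_one, mul_zero, add_zero, mul_one] at h
  have e : t * (1 - v) + (1 - t) = 1 - t * v := by ring
  rwa [e] at h

/-- `μ_j` is monotone in `x` on `[0, 1/j)`. -/
theorem mu_mono {j : ℕ} {x y : ℝ} (hx : 0 ≤ x) (hxy : x ≤ y) (hy : (j : ℝ) * y < 1) :
    mu j x ≤ mu j y := by
  unfold mu
  rcases eq_or_lt_of_le hx with hx0 | hx'
  · subst hx0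
    rw [if_pos rfl]
    by_cases hy0 : y = 0
    · simp [hy0]
    · have hy' : 0 < y := lt_of_le_of_ne hxy (Ne.symm hy0)
      rw [if_neg hy0, le_div_iff₀ hy']
      have := Real.log_le_sub_one_of_pos (x := 1 - j * y) (by linarith)
      linarith
  · have hy' : 0 < y := lt_of_lt_of_le hx' hxy
    rw [if_neg hx'.ne', if_neg hy'.ne', div_le_div_iff₀ hx' hy']
    have ht := log_one_sub_concave (t := x / y) (v := j * y) (div_nonneg hx hy'.le)
      ((div_le_one hy').2 hxy) hy
    have e1 : x / y * (↑j * y) = j * x := by field_simp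
    rw [e1] at ht
    have h2 := mul_le_mul_of_nonneg_left ht hy'.le
    have e2 : y * (x / y * Real.log (1 - j * y)) = x * Real.log (1 - j * y) := by field_simp
    rw [e2] at h2
    nlinarith [h2]

/-- Soundness/assembly step `mem_muE` (P-POS package; see the module docstring). -/
theorem mem_muE {X j : ℕ} (hok : muOK X j = true) : mem (mu j ((X : ℝ) / DX)) (muE X j) := by
  unfold mu muE
  by_cases hX0 : X = 0
  · subst hX0
    simp only [Nat.cast_zero, zero_div, if_true]
    exact_mod_cast Numerics.FI.mem_ofInt (j : ℤ)
  · have hDX : (DX : ℝ) ≠ 0 := DX_pos.ne'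
    have hXr : (X : ℝ) ≠ 0 := by exact_mod_cast hX0
    have hXr' : (X : ℝ) / DX ≠ 0 := div_ne_zero hXr hDX
    rw [if_neg hXr', if_neg hX0]
    have hok' : logOneSubOK (ofFrac ((j * X : ℕ) : ℤ) DX) KLOG = true := by
      simpa [muOK, hX0] using hok
    have h1 := mem_logOneSubD hok' (mem_ofFrac ((j * X : ℕ) : ℤ) (q := DX) (by norm_num [DX]))
    have h2 := mem_divNat (mem_mulInt (mem_neg h1) (DX : ℤ)) (n := X) (Nat.pos_of_ne_zero hX0)
    convert h2 using 1
    push_cast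
    field_simp

/-- Soundness/assembly step `mem_muTab` (P-POS package; see the module docstring). -/
theorem mem_muTab {X : ℕ} (hok : muTabOK X = true) {j : ℕ} (hj : j < 16) :
    mem (mu j ((X : ℝ) / DX)) (getI (muTab X) j) := by
  rw [muTab, getI_map_range _ hj]
  have : muOK X j = true := by
    rw [muTabOK, List.all_eq_true] at hok; exact hok j (List.mem_range.2 hj)
  exact mem_muE this

/-- Soundness/assembly step `FR_congr` (P-POS package; see the module docstring). -/
theorem FR_congr {φ : ℝ} {m m' : ℕ → ℝ} (h : ∀ j, j < 16 → m j = m' j) : FR φ m = FR φ m' := by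
  unfold FR; congr 1
  refine List.map_congr_left fun e he => ?_
  obtain ⟨ha, hb, -⟩ := edgeL_wf e he
  rw [h _ ha, h _ hb]

/-- Soundness/assembly step `goodBox_of_outside` (P-POS package; see the module docstring). -/
theorem goodBox_of_outside {P0 P1 X0 X1 : ℕ} (h : outside P0 X0 = true) : GoodBox P0 P1 X0 X1 := by
  intro x φ hx0 _ hφ0 _ hwin
  exfalso
  have h' : 21 * DP * DX < 50 * P0 * DX + 168 * DP * X0 := of_decide_eq_true h
  have h'' : (21 : ℝ) * DP * DX < 50 * P0 * DX + 168 * DP * X0 := by exact_mod_cast h'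
  rw [div_le_iff₀ DX_pos] at hx0
  rw [div_le_iff₀ DP_pos] at hφ0
  have hDX := DX_pos; have hDP := DP_pos
  nlinarith [mul_le_mul_of_nonneg_right hφ0 (by positivity : (0:ℝ) ≤ 50 * DX),
    mul_le_mul_of_nonneg_right hx0 (by positivity : (0:ℝ) ≤ 168 * DP), mul_pos hDP hDX]

/-- Soundness/assembly step `goodBox_of_accept` (P-POS package; see the module docstring). -/
theorem goodBox_of_accept {P0 P1 X0 X1 : ℕ} (hP : P0 ≤ P1) (hX1 : X1 ≤ 128)
    (h0 : muTabOK X0 = true) (h1 : muTabOK X1 = true)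
    (hacc : accept (cellLB (mkCol (muTab X0) (muTab X1)) P0 P1) = true) : GoodBox P0 P1 X0 X1 := by
  intro x φ hx0 hx1 hφ0 hφ1 _
  have hxnn : 0 ≤ x := le_trans (by positivity) hx0
  have hx15 : ∀ j : ℕ, j < 16 → (j : ℝ) * ((X1 : ℝ) / DX) < 1 := by
    intro j hj
    have hj15 : j ≤ 15 := by omega
    have hj' : (j : ℝ) ≤ 15 := by exact_mod_cast hj15
    have hX1' : (X1 : ℝ) ≤ 128 := by exact_mod_cast hX1
    rw [show (j : ℝ) * ((X1 : ℝ) / DX) = j * X1 / DX by ring, div_lt_one DX_pos]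
    norm_num [DX]; nlinarith
  have hxj : ∀ j : ℕ, j < 16 → (j : ℝ) * x < 1 := fun j hj =>
    lt_of_le_of_lt (mul_le_mul_of_nonneg_left hx1 (Nat.cast_nonneg j)) (hx15 j hj)
  set lo : ℕ → ℝ := fun j => if j < 16 then mu j ((X0 : ℝ) / DX) else 0 with hlo
  set hi : ℕ → ℝ := fun j => if j < 16 then mu j ((X1 : ℝ) / DX) else 0 with hhi
  set m : ℕ → ℝ := fun j => if j < 16 then mu j x else 0 with hmdef
  have hm : ∀ j, lo j ≤ m j ∧ m j ≤ hi j := by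
    intro j
    by_cases hj : j < 16
    · simp only [hlo, hhi, hmdef, hj, if_true]
      exact ⟨mu_mono (by positivity) hx0 (hxj j hj), mu_mono hxnn hx1 (hx15 j hj)⟩
    · simp [hlo, hhi, hmdef, hj]
  have hres := cell_sound (muTab X0) (muTab X1) hP lo hi m
    (fun j hj => by simp only [hlo, hj, if_true]; exact mem_muTab h0 hj)
    (fun j hj => by simp only [hhi, hj, if_true]; exact mem_muTab h1 hj) hm hφ0 hφ1 hacc
  rwa [FR_congr (m := m) (m' := fun j => mu j x) (fun j hj => by simp [hmdef, hj])] at hres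

/-- Soundness/assembly step `goodBox_union_P` (P-POS package; see the module docstring). -/
theorem goodBox_union_P {P0 Pm P1 X0 X1 : ℕ} (h1 : GoodBox P0 Pm X0 X1) (h2 : GoodBox Pm P1 X0 X1) :
    GoodBox P0 P1 X0 X1 := by
  intro x φ hx0 hx1 hφ0 hφ1 hw
  rcases le_total φ ((Pm : ℝ) / DP) with h | h
  · exact h1 x φ hx0 hx1 hφ0 h hw
  · exact h2 x φ hx0 hx1 h hφ1 hw

/-- Soundness/assembly step `goodBox_union_X` (P-POS package; see the module docstring). -/
theorem goodBox_union_X {P0 P1 X0 Xm X1 : ℕ} (h1 : GoodBox P0 P1 X0 Xm) (h2 : GoodBox P0 P1 Xm X1) :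
    GoodBox P0 P1 X0 X1 := by
  intro x φ hx0 hx1 hφ0 hφ1 hw
  rcases le_total x ((Xm : ℝ) / DX) with h | h
  · exact h1 x φ hx0 h hφ0 hφ1 hw
  · exact h2 x φ h hx1 hφ0 hφ1 hw

/-- SOUNDNESS OF THE CHECKER. -/
theorem certify_sound : ∀ (fuel P0 P1 X0 X1 : ℕ), P0 ≤ P1 → X0 ≤ X1 → X1 ≤ 128 →
    certify fuel P0 P1 X0 X1 = true → GoodBox P0 P1 X0 X1 := by
  intro fuel
  induction fuel with
  | zero => intro P0 P1 X0 X1 _ _ _ h; simp [certify] at h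
  | succ fuel ih =>
    intro P0 P1 X0 X1 hP hX hX1 h
    rw [certify] at h
    simp only [Bool.or_eq_true, Bool.and_eq_true] at h
    rcases h with hout | ⟨⟨h0, h1⟩, h⟩
    · exact goodBox_of_outside hout
    rcases h with hacc | h
    · exact goodBox_of_accept hP hX1 h0 h1 hacc
    split_ifs at h with hc
    · simp only [Bool.and_eq_true] at h
      obtain ⟨⟨-, hA⟩, hB⟩ := h
      exact goodBox_union_P (ih _ _ _ _ (by omega) hX hX1 hA) (ih _ _ _ _ (by omega) hX hX1 hB)
    · simp only [Bool.and_eq_true] at h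
      obtain ⟨hA, hB⟩ := h
      exact goodBox_union_X (ih _ _ _ _ hP (by omega) (by omega) hA) (ih _ _ _ _ hP (by omega) hX1 hB)

end Certify

end Summit.RiemannHypothesis.RiemannHypothesis.Theorems.IntegerScrew.TopBlockPos
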